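import Literature.AnabelianGeometry.EtaleTheta.ThetaSubquotientOfTemperedGalois
import Literature.AnabelianGeometry.SemiGraphs.TemperoidsResProofs

/-!
# [EtTh] §5: the theta subquotient at the Galois objects `Π/N` of `B^temp(Π)` — explicitly

Mochizuki, *The étale theta function and its Frobenioid-theoretic manifestations*, Publ. RIMS **45**
(2009), §5 p. 327 (PDF p. 101) [cite: MochizukiEtTh2009, §5 p.327 (PDF p.101)]; the Galois objects `Π/N`
of `B^temp(Π)` are [SemiAnbd] Rmk. 3.1.2/3.1.3 (abc-iut-L3-t2's `SemiGraphs.BTemp.Q hG N`,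
`TemperoidsResProofs.lean`).  abc-iut cell, layer L2, seat abc-iut-L2-t9 (unit W2-L2-05; companion to
`ThetaSubquotientOfTempered{,Galois}.lean`).  Staged 2026-08-25T23:42Z by abc-iut-L2-t9 (gen 2) (staging sha12 5e4b87eb9648) and
filed (minus `autProj_Q_surjective`, see below) with credit by abc-iut-w4-d042 (gen 3), MERGE-PLAN row 2 (D).

For a tempered group `Π`, an open normal subgroup `N`, `q : Π ↠ Q` SURJECTIVE and `ι : Λ → Q` with normal
image `L`: the stabilisers of `Π/N` are all `N` (`stabilizerSubgroup_Q`), `Π/N` is connected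
(`isConnectedObj_Q`), and

  `(l·Δ_Θ)_{Π/N} ≃* Λ / ι⁻¹(q(N) ∩ L)`   (`lDeltaQEquiv`),

i.e. print's `L·q(N)/q(N) ⊆ Q/q(N) = Aut^Θ(Π/N)`: at the objects where §5 evaluates `(l·Δ_Θ)_(−)`, the R2 carrier IS
print's subquotient of `Aut_D(Π/N) = Π/N`.  (Surjectivity of the `Aut`-projection onto it at Galois objects is
abc-iut-w5-d249's `ThetaSubquotientOfTemperedAut.lean` p428064 + companion — the `Aut`-projection of record, L2-lead R120
2026-08-26T06:20Z; abc-iut-L2-t9's staged `autProj_Q_surjective` over the superseded staged `Aut` text is therefore not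
filed here.)  Nothing is asserted about [EtTh]'s curves.
-/

noncomputable section

namespace Literature.AnabelianGeometry.EtaleTheta

namespace ThetaSubquotient

open CategoryTheory Literature.AlgebraicGeometry.Frobenioids Literature.AnabelianGeometry.SemiGraphs
open Literature.AlgebraicGeometry.Frobenioids.QuasiTemperoid (stabilizerSubgroup)
open Literature.AlgebraicGeometry.Frobenioids.QuasiTemperoid.BTempConnected (isConnectedObj_of_transitive)

universe u v w

variable {G : Type u} [Group G] [TopologicalSpace G] [IsTopologicalGroup G] (hG : IsTempered G)
  {Q : Type v} [Group Q] {Λ : Type w} [CommGroup Λ] (q : G →* Q) (ι : Λ →* Q)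

/-- The stabiliser of any point of the Galois object `Π/N` is `N`.
[cite: MochizukiEtTh2009, §5 p.327 (PDF p.101)] -/
theorem stabilizerSubgroup_Q (N : OpenNormalSubgroup G) (y : G) :
    stabilizerSubgroup (BTemp.Q hG N) (y : G ⧸ N.toSubgroup) = N.toSubgroup := by
  ext g
  rw [QuasiTemperoid.mem_stabilizerSubgroup_iff, BTemp.Q_ρ_apply]
  change ((g * y : G) : G ⧸ N.toSubgroup) = (y : G ⧸ N.toSubgroup) ↔ g ∈ N.toSubgroup
  rw [QuotientGroup.eq, mul_inv_rev, Subgroup.Normal.mem_comm_iff inferInstance, ← mul_assoc,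
    mul_inv_cancel, one_mul, inv_mem_iff]

/-- The Galois object `Π/N` is connected (a single orbit).
[cite: MochizukiEtTh2009, §5 p.327 (PDF p.101)] -/
theorem isConnectedObj_Q (N : OpenNormalSubgroup G) : IsConnectedObj (BTemp.Q hG N) := by
  refine isConnectedObj_of_transitive (BTemp.Q hG N) ((1 : G) : G ⧸ N.toSubgroup) fun z => ?_
  obtain ⟨g, rfl⟩ := QuotientGroup.mk_surjective z
  exact ⟨g, by rw [BTemp.Q_ρ_apply, mul_one]⟩

variable [ι.range.Normal]

/-- **`(l·Δ_Θ)_{Π/N} ≅ Λ/ι⁻¹(q(N) ∩ L)`** for an open normal `N` and surjective `q`: print's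
`L·q(N)/q(N)`, the image of `l·Δ_Θ` in `Aut^Θ_D(Π/N) = Q/q(N)` (evaluation at the coset of `1`, then
`killQ_eq_of_normal`). [cite: MochizukiEtTh2009, §5 p.327 (PDF p.101)] -/
def lDeltaQEquiv (hq : Function.Surjective q) (N : OpenNormalSubgroup G) :
    LDelta q ι (BTemp.Q hG N) ≃* Λ ⧸ (N.toSubgroup.map q ⊓ ι.range).comap ι :=
  haveI : (N.toSubgroup.map q).Normal := Subgroup.Normal.map inferInstance q hq
  (evalEquiv q ι (isConnectedObj_Q hG N) ((1 : G) : G ⧸ N.toSubgroup)).trans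
    (QuotientGroup.quotientMulEquivOfEq (by rw [stabilizerSubgroup_Q, kill_eq_of_normal]))

/-- `lDeltaQEquiv` on the class of a compatible family: the class of its value at the coset of `1`.
[cite: MochizukiEtTh2009, §5 p.327 (PDF p.101)] -/
theorem lDeltaQEquiv_mk (hq : Function.Surjective q) (N : OpenNormalSubgroup G)
    (t : Fam q ι (BTemp.Q hG N)) :
    lDeltaQEquiv hG q ι hq N (mk q ι _ t) =
      QuotientGroup.mk ((t : (BTemp.Q hG N).obj.V → Λ) ((1 : G) : G ⧸ N.toSubgroup)) := by
  haveI : (N.toSubgroup.map q).Normal := Subgroup.Normal.map inferInstance q hq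
  simp [lDeltaQEquiv]

end ThetaSubquotient

end Literature.AnabelianGeometry.EtaleTheta

end
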